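import Summits.MatrixMultiplication.OmegaCensus.DihedralLawModOneShapeB
import Summits.MatrixMultiplication.OmegaCensus.CubePairCyclic
import HarnessLib

/-!
# Cube law shapes with a part pair of size 2 force a cyclic group

ω-census, family (b3).  Framing: lottery ticket; floor = certified bounds/negative ranges.

Dihedral-like `G` over a finite abelian `A` (`ρaρb = ρ(a+b)`, `ρaτb = τ(b−a)`, `τaρb = τ(a+b)`, `τaτb = ρ(c₀+b−a)`);
a TPP triple `(S, T, U)` with cube part sizes `(c,c | 2,2 | e,e)` — `T`-parts `{b₁, b₁+t}`, `{b₃, b₃+t′}`, equal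
`S`-parts, equal `U`-parts — attaining the law `3|S||T||U| + 8 = 8|A|`.
* `cube_pair_indicator_identities`: the vertex-`000` near-tiling of the triple and of its `T·τ0`-translate
  (`TripleProductProperty.map_mulRight`) are the indicator identities (i), (ii′) of Lemma Q
  (`FAMILY-B-ADDENDUM-g4.md` §7) for `M = (S₁+U₀+b₁) ∪ (S₀+U₁+b₁)`, `P = S₀+U₀+b₃`, with `|M| = 2|P|`,
  `|A| = 2|M| + 2|P| + 1` (`|A|` is odd here, so `c₀ = 0` automatically);
* **`cyclic_of_law_cube_pair`**: hence (`exists_zmultiples_eq_top_of_near_tilings`, `CubePairCyclic.lean`)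
  `A` IS CYCLIC.  In particular no dihedral-like group over a NON-cyclic `A` attains the law through a cube shape
  containing a part pair of size 2 — e.g. `Dih(ℤ₅²)` (order 50; the only shapes at `|A| = 25` are `(1,2,4)`,
  `(2,2,2)`, both with a 2, and the non-cube shapes force two cosets of a cyclic group, `DihedralLawModOneNonCube`);
* `cyclic_of_law_cube_pair_of_generator`: if moreover `t + t′` or `t′ − t` generates `A`, then `t′ = ±t`
  (`aligned_of_generator`) and `A = x₀ + ⟨t⟩` (`cyclic_of_law_cube_aligned_pair`).
-/

namespace Summit.MatrixMultiplication.OmegaCensus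

open Literature.Combinatorics.Additive Finset

section Tools

variable {A : Type*} [AddCommGroup A] [Fintype A] [DecidableEq A]

omit [AddCommGroup A] in
/-- Four pairwise disjoint sets of total size `|A| − 1` miss exactly one point: indicator form. [folklore] -/
theorem indicator4_of_disjoint {X₁ X₂ X₃ X₄ : Finset A}
    (h12 : Disjoint X₁ X₂) (h13 : Disjoint X₁ X₃) (h14 : Disjoint X₁ X₄) (h23 : Disjoint X₂ X₃)
    (h24 : Disjoint X₂ X₄) (h34 : Disjoint X₃ X₄)
    (hcard : X₁.card + X₂.card + X₃.card + X₄.card + 1 = Fintype.card A) :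
    ∃ x : A, ∀ y : A, ((if y ∈ X₁ then (1 : ℤ) else 0) + (if y ∈ X₂ then 1 else 0) + (if y ∈ X₃ then 1 else 0) +
      (if y ∈ X₄ then 1 else 0)) = if y = x then 0 else 1 := by
  set Q := X₁ ∪ X₂ ∪ X₃ ∪ X₄ with hQ
  have cQ : Q.card = X₁.card + X₂.card + X₃.card + X₄.card := by
    rw [hQ, card_union_of_disjoint (disjoint_union_left.2 ⟨disjoint_union_left.2 ⟨h14, h24⟩, h34⟩),
      card_union_of_disjoint (disjoint_union_left.2 ⟨h13, h23⟩), card_union_of_disjoint h12]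
  have hR : (univ \ Q).card = 1 := by rw [card_univ_sdiff, cQ]; omega
  obtain ⟨x, hx⟩ := card_eq_one.1 hR
  refine ⟨x, fun y => ?_⟩
  by_cases hy : y = x
  · subst hy
    have : y ∉ Q := by
      have h : y ∈ univ \ Q := by rw [hx]; exact mem_singleton_self _
      exact (mem_sdiff.1 h).2
    rw [hQ] at this
    simp only [mem_union, not_or] at this
    obtain ⟨⟨⟨h1, h2⟩, h3⟩, h4⟩ := this
    rw [if_neg h1, if_neg h2, if_neg h3, if_neg h4, if_pos rfl]; norm_num
  · rw [if_neg hy]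
    have hyQ : y ∈ Q := by
      by_contra hc
      have : y ∈ univ \ Q := mem_sdiff.2 ⟨mem_univ _, hc⟩
      rw [hx, mem_singleton] at this; exact hy this
    rw [hQ] at hyQ
    simp only [mem_union] at hyQ
    rcases hyQ with ((h1 | h2) | h3) | h4
    · rw [if_pos h1, if_neg (disjoint_left.1 h12 h1), if_neg (disjoint_left.1 h13 h1),
        if_neg (disjoint_left.1 h14 h1)]; norm_num
    · rw [if_neg (disjoint_right.1 h12 h2), if_pos h2, if_neg (disjoint_left.1 h23 h2),
        if_neg (disjoint_left.1 h24 h2)]; norm_num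
    · rw [if_neg (disjoint_right.1 h13 h3), if_neg (disjoint_right.1 h23 h3), if_pos h3,
        if_neg (disjoint_left.1 h34 h3)]; norm_num
    · rw [if_neg (disjoint_right.1 h14 h4), if_neg (disjoint_right.1 h24 h4), if_neg (disjoint_right.1 h34 h4),
        if_pos h4]; norm_num

omit [DecidableEq A] in
/-- In a group of odd order, `c + c = 0` forces `c = 0`. [folklore] -/
theorem eq_zero_of_add_self_of_odd_card {c : A} (h2 : c + c = 0) (hodd : Odd (Fintype.card A)) : c = 0 := by
  have h1 : addOrderOf c ∣ 2 := addOrderOf_dvd_of_nsmul_eq_zero (by rw [two_nsmul]; exact h2)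
  have h3 : addOrderOf c ∣ Fintype.card A := addOrderOf_dvd_card
  obtain ⟨k, hk⟩ := hodd
  have hle : addOrderOf c ≤ 2 := Nat.le_of_dvd two_pos h1
  have hpos : 0 < addOrderOf c := addOrderOf_pos c
  have hne2 : addOrderOf c ≠ 2 := by
    intro h; rw [h, hk] at h3; omega
  have : addOrderOf c = 1 := by omega
  exact AddMonoid.addOrderOf_eq_one_iff.1 this

end Tools

section DihedralLike

variable {A : Type*} [AddCommGroup A] [DecidableEq A] [Fintype A] {G : Type} [Group G] [DecidableEq G]
  {ρ τ : A → G} {c₀ : A} {S T U : Finset G}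

/-- The box structure of vertex `000` when the `T`-parts contain `{p, p+t}` resp. `{p', p'+t'}`: with
`Y₁ = S₁+U₀+p`, `Y₃ = S₀+U₁+p`, `Y₂ = S₀+U₀+p'`, the four sets `Y₁ ∪ Y₃`, `(Y₁ ∪ Y₃) + t`, `Y₂`, `Y₂ + t'` are
pairwise disjoint, of sizes `s₁u₀ + s₀u₁` (twice) and `s₀u₀` (twice). [folklore] -/
theorem vertex000_pieces
    (hρρ : ∀ a b, ρ a * ρ b = ρ (a + b)) (hρτ : ∀ a b, ρ a * τ b = τ (b - a))
    (hτρ : ∀ a b, τ a * ρ b = τ (a + b)) (hττ : ∀ a b, τ a * τ b = ρ (c₀ + b - a))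
    (hρ : Function.Injective ρ) (hτ : Function.Injective τ) (hne : ∀ a b, ρ a ≠ τ b)
    (h : TripleProductProperty S T U) {p p' t t' : A} (ht : t ≠ 0) (ht' : t' ≠ 0)
    (mT₀ : ∀ b ∈ ({p, p + t} : Finset A), ρ b ∈ T) (mT₁ : ∀ b ∈ ({p', p' + t'} : Finset A), τ b ∈ T) :
    let S₀ := univ.filter fun a : A => ρ a ∈ S
    let S₁ := univ.filter fun a : A => τ a ∈ S
    let U₀ := univ.filter fun a : A => ρ a ∈ U
    let U₁ := univ.filter fun a : A => τ a ∈ U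
    let M := ((S₁ ×ˢ U₀).image fun q : A × A => q.1 + q.2 + p) ∪ ((S₀ ×ˢ U₁).image fun q : A × A => q.1 + q.2 + p)
    let P := (S₀ ×ˢ U₀).image fun q : A × A => q.1 + q.2 + p'
    Disjoint M (M.image (· + t)) ∧ Disjoint M P ∧ Disjoint M (P.image (· + t')) ∧
      Disjoint (M.image (· + t)) P ∧ Disjoint (M.image (· + t)) (P.image (· + t')) ∧ Disjoint P (P.image (· + t')) ∧
      M.card = S₁.card * U₀.card + S₀.card * U₁.card ∧ P.card = S₀.card * U₀.card := by
  intro S₀ S₁ U₀ U₁ M P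
  have hpt : p ≠ p + t := fun e => ht (by have := e; rw [eq_comm, ← sub_eq_zero] at this; simpa using this)
  have hpt' : p' ≠ p' + t' := fun e => ht' (by have := e; rw [eq_comm, ← sub_eq_zero] at this; simpa using this)
  have mS₀ : ∀ a ∈ S₀, cond false (τ a) (ρ a) ∈ S := fun a ha => (mem_filter.1 ha).2
  have mS₁ : ∀ a ∈ S₁, cond true (τ a) (ρ a) ∈ S := fun a ha => (mem_filter.1 ha).2
  have mS₀' : ∀ a ∈ S₀, ρ a ∈ S := mS₀
  have mS₁' : ∀ a ∈ S₁, τ a ∈ S := mS₁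
  have mT₀c : ∀ b ∈ ({p, p + t} : Finset A), cond false (τ b) (ρ b) ∈ T := mT₀
  have mT₁c : ∀ b ∈ ({p', p' + t'} : Finset A), cond true (τ b) (ρ b) ∈ T := mT₁
  have mU₀ : ∀ c ∈ U₀, cond false (τ c) (ρ c) ∈ U := fun c hc => (mem_filter.1 hc).2
  have mU₁ : ∀ c ∈ U₁, cond true (τ c) (ρ c) ∈ U := fun c hc => (mem_filter.1 hc).2
  have mU₀' : ∀ c ∈ U₀, ρ c ∈ U := mU₀
  have mU₁' : ∀ c ∈ U₁, τ c ∈ U := mU₁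
  have cs := card_sumset' hρρ hττ hρ hτ h
  have d₁ := disjoint_sumset₁' hρρ hρτ hτρ hττ hne h
  have d₂ := disjoint_sumset₂' hρρ hρτ hτρ hττ hne h
  have d₃ := disjoint_sumset₃' hρρ hρτ hτρ hττ hne h
  have c100 := cs true false false mS₁ mT₀c mU₀
  have c010 := cs false true false mS₀ mT₁c mU₀
  have c001 := cs false false true mS₀ mT₀c mU₁
  have D12 := d₁ false mS₁' mT₀ mU₀ mS₀' mT₁
  have D23 := d₂ false mS₀ mT₁ mU₀' mS₀ mT₀ mU₁'
  have D31 := d₃ false mS₀' mT₀c mU₁' mS₁' mU₀'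
  rw [card_pair hpt] at c100 c001
  rw [card_pair hpt'] at c010
  simp only [sumset_domino_mid] at c100 c010 c001 D12 D23 D31
  set Y₁ := (S₁ ×ˢ U₀).image fun q : A × A => q.1 + q.2 + p with hY₁
  set Y₂ := (S₀ ×ˢ U₀).image fun q : A × A => q.1 + q.2 + p' with hY₂
  set Y₃ := (S₀ ×ˢ U₁).image fun q : A × A => q.1 + q.2 + p with hY₃
  have cY₁le : Y₁.card ≤ S₁.card * U₀.card := by rw [hY₁, ← card_product]; exact card_image_le
  have cY₂le : Y₂.card ≤ S₀.card * U₀.card := by rw [hY₂, ← card_product]; exact card_image_le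
  have cY₃le : Y₃.card ≤ S₀.card * U₁.card := by rw [hY₃, ← card_product]; exact card_image_le
  have u1 := card_union_le Y₁ (Y₁.image (· + t)); rw [card_image_add] at u1
  have u2 := card_union_le Y₂ (Y₂.image (· + t')); rw [card_image_add] at u2
  have u3 := card_union_le Y₃ (Y₃.image (· + t)); rw [card_image_add] at u3
  have cY₁ : Y₁.card = S₁.card * U₀.card := by
    have : S₁.card * 2 * U₀.card ≤ Y₁.card + Y₁.card := c100 ▸ u1
    nlinarith
  have cY₂ : Y₂.card = S₀.card * U₀.card := by
    have : S₀.card * 2 * U₀.card ≤ Y₂.card + Y₂.card := c010 ▸ u2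
    nlinarith
  have cY₃ : Y₃.card = S₀.card * U₁.card := by
    have : S₀.card * 2 * U₁.card ≤ Y₃.card + Y₃.card := c001 ▸ u3
    nlinarith
  have dY₁ : Disjoint Y₁ (Y₁.image (· + t)) :=
    card_union_eq_card_add_card.1 (by rw [card_image_add, c100, cY₁]; ring)
  have dY₂ : Disjoint Y₂ (Y₂.image (· + t')) :=
    card_union_eq_card_add_card.1 (by rw [card_image_add, c010, cY₂]; ring)
  have dY₃ : Disjoint Y₃ (Y₃.image (· + t)) :=
    card_union_eq_card_add_card.1 (by rw [card_image_add, c001, cY₃]; ring)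
  -- `M = Y₁ ∪ Y₃`, `M + t = Y₁+t ∪ Y₃+t`
  have hMt : M.image (· + t) = Y₁.image (· + t) ∪ Y₃.image (· + t) := by
    show (Y₁ ∪ Y₃).image (· + t) = _; rw [image_union]
  have d13 : Disjoint (Y₁ ∪ Y₁.image (· + t)) (Y₃ ∪ Y₃.image (· + t)) := D31.symm
  refine ⟨?_, ?_, ?_, ?_, ?_, dY₂, ?_, cY₂⟩
  · rw [hMt]; show Disjoint (Y₁ ∪ Y₃) _
    refine disjoint_union_left.2 ⟨disjoint_union_right.2 ⟨dY₁, ?_⟩, disjoint_union_right.2 ⟨?_, dY₃⟩⟩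
    · exact disjoint_of_subset_left subset_union_left (disjoint_of_subset_right subset_union_right d13)
    · exact disjoint_of_subset_left subset_union_left (disjoint_of_subset_right subset_union_right d13.symm)
  · show Disjoint (Y₁ ∪ Y₃) Y₂
    exact disjoint_union_left.2 ⟨disjoint_of_subset_left subset_union_left (disjoint_of_subset_right
      subset_union_left D12), disjoint_of_subset_left subset_union_left (disjoint_of_subset_right subset_union_left
      D23.symm)⟩
  · show Disjoint (Y₁ ∪ Y₃) (Y₂.image (· + t'))
    exact disjoint_union_left.2 ⟨disjoint_of_subset_left subset_union_left (disjoint_of_subset_right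
      subset_union_right D12), disjoint_of_subset_left subset_union_left (disjoint_of_subset_right subset_union_right
      D23.symm)⟩
  · rw [hMt]
    exact disjoint_union_left.2 ⟨disjoint_of_subset_left subset_union_right (disjoint_of_subset_right
      subset_union_left D12), disjoint_of_subset_left subset_union_right (disjoint_of_subset_right subset_union_left
      D23.symm)⟩
  · rw [hMt]
    exact disjoint_union_left.2 ⟨disjoint_of_subset_left subset_union_right (disjoint_of_subset_right
      subset_union_right D12), disjoint_of_subset_left subset_union_right (disjoint_of_subset_right subset_union_right
      D23.symm)⟩
  · show (Y₁ ∪ Y₃).card = _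
    rw [card_union_of_disjoint (disjoint_of_subset_left subset_union_left (disjoint_of_subset_right subset_union_left
      d13)), cY₁, cY₃]

omit [Fintype A] in
/-- Translating the box offset: `X + Y + p = (X + Y + b) + (p − b)`. [folklore] -/
theorem image_sum_shift (Z : Finset (A × A)) (b p : A) :
    (Z.image fun q : A × A => q.1 + q.2 + p) = (Z.image fun q : A × A => q.1 + q.2 + b).image (· + (p - b)) := by
  rw [image_image]
  exact image_congr fun q _ => by simp only [Function.comp_apply]; abel

/-- **The two indicator identities of a cube pair.**  For a TPP triple in a dihedral-like group with `T`-parts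
`{b₁, b₁+t}`, `{b₃, b₃+t'}`, equal `S`-parts and equal `U`-parts, attaining the law, the sets
`M = (S₁+U₀+b₁) ∪ (S₀+U₁+b₁)` and `P = S₀+U₀+b₃` satisfy the near-tiling identities (i) (vertex `000` of the triple)
and (ii′) (vertex `000` of the `T·τ0`-translated triple, shifted back), with `|M| = 2|P|`, `|A| = 2|M| + 2|P| + 1`.
[folklore] -/
theorem cube_pair_indicator_identities
    (hρρ : ∀ a b, ρ a * ρ b = ρ (a + b)) (hρτ : ∀ a b, ρ a * τ b = τ (b - a))
    (hτρ : ∀ a b, τ a * ρ b = τ (a + b)) (hττ : ∀ a b, τ a * τ b = ρ (c₀ + b - a))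
    (hρ : Function.Injective ρ) (hτ : Function.Injective τ) (hne : ∀ a b, ρ a ≠ τ b)
    (hsurj : ∀ g, (∃ a, ρ a = g) ∨ (∃ a, τ a = g)) (h : TripleProductProperty S T U) {b₁ b₃ t t' : A}
    (ht : t ≠ 0) (ht' : t' ≠ 0)
    (hT₀ : (univ.filter fun a : A => ρ a ∈ T) = {b₁, b₁ + t})
    (hT₁ : (univ.filter fun a : A => τ a ∈ T) = {b₃, b₃ + t'})
    (hS : (univ.filter fun a : A => ρ a ∈ S).card = (univ.filter fun a : A => τ a ∈ S).card)
    (hU : (univ.filter fun a : A => ρ a ∈ U).card = (univ.filter fun a : A => τ a ∈ U).card)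
    (hV : 3 * (S.card * T.card * U.card) + 8 = 8 * Fintype.card A) :
    let S₀ := univ.filter fun a : A => ρ a ∈ S
    let S₁ := univ.filter fun a : A => τ a ∈ S
    let U₀ := univ.filter fun a : A => ρ a ∈ U
    let U₁ := univ.filter fun a : A => τ a ∈ U
    let M := ((S₁ ×ˢ U₀).image fun q : A × A => q.1 + q.2 + b₁) ∪ ((S₀ ×ˢ U₁).image fun q : A × A => q.1 + q.2 + b₁)
    let P := (S₀ ×ˢ U₀).image fun q : A × A => q.1 + q.2 + b₃
    (∃ x₀ : A, ∀ y : A, ((if y ∈ M then (1 : ℤ) else 0) + (if y - t ∈ M then 1 else 0) + (if y ∈ P then 1 else 0) +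
      (if y - t' ∈ P then 1 else 0)) = if y = x₀ then 0 else 1) ∧
    (∃ x₀' : A, ∀ y : A, ((if y ∈ M then (1 : ℤ) else 0) + (if y - t' ∈ M then 1 else 0) +
      (if y - t' ∈ P then 1 else 0) + (if y - (t' - t) ∈ P then 1 else 0)) = if y = x₀' then 0 else 1) ∧
    M.card = 2 * P.card ∧ Fintype.card A = 2 * M.card + 2 * P.card + 1 := by
  intro S₀ S₁ U₀ U₁ M P
  have hbt : b₁ ≠ b₁ + t := fun e => ht (by have := e; rw [eq_comm, ← sub_eq_zero] at this; simpa using this)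
  have hbt' : b₃ ≠ b₃ + t' := fun e => ht' (by have := e; rw [eq_comm, ← sub_eq_zero] at this; simpa using this)
  have h2c : c₀ + c₀ = 0 := two_c0_eq_zero hρτ hτρ hττ hτ
  -- numerics
  have cS := card_eq_parts' hρ hτ hne hsurj S
  have cT := card_eq_parts' hρ hτ hne hsurj T
  have cU := card_eq_parts' hρ hτ hne hsurj U
  rw [hT₀, hT₁, card_pair hbt, card_pair hbt'] at cT
  have hprod : S.card * T.card * U.card = 16 * (S₀.card * U₀.card) := by
    rw [cS, cT, cU]; show (S₀.card + S₁.card) * (2 + 2) * (U₀.card + U₁.card) = _; rw [← hS, ← hU]; ring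
  rw [hprod] at hV
  have hN : Fintype.card A = 6 * (S₀.card * U₀.card) + 1 := by omega
  have hodd : Odd (Fintype.card A) := ⟨3 * (S₀.card * U₀.card), by rw [hN]; ring⟩
  have hc₀ : c₀ = 0 := eq_zero_of_add_self_of_odd_card h2c hodd
  have e1 : S₁.card * U₀.card = S₀.card * U₀.card := by show _ * _ = _; rw [hS]
  have e2 : S₀.card * U₁.card = S₀.card * U₀.card := by show _ * _ = _; rw [hU]
  -- memberships of the `T`-parts
  have mT₀ : ∀ b ∈ ({b₁, b₁ + t} : Finset A), ρ b ∈ T := fun b hb => by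
    have hb' : b ∈ univ.filter fun a : A => ρ a ∈ T := by rw [hT₀]; exact hb
    exact (mem_filter.1 hb').2
  have mT₁ : ∀ b ∈ ({b₃, b₃ + t'} : Finset A), τ b ∈ T := fun b hb => by
    have hb' : b ∈ univ.filter fun a : A => τ a ∈ T := by rw [hT₁]; exact hb
    exact (mem_filter.1 hb').2
  -- (i): vertex 000 of the triple itself
  obtain ⟨d12, d13, d14, d23, d24, d34, cM, cP⟩ := vertex000_pieces hρρ hρτ hτρ hττ hρ hτ hne h ht ht' mT₀ mT₁
  have hMP : M.card = 2 * P.card := by rw [cM, cP, e1, e2]; ring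
  have hN' : Fintype.card A = 2 * M.card + 2 * P.card + 1 := by rw [cM, cP, e1, e2, hN]; ring
  refine ⟨?_, ?_, hMP, hN'⟩
  · have hc : M.card + (M.image (· + t)).card + P.card + (P.image (· + t')).card + 1 = Fintype.card A := by
      rw [card_image_add, card_image_add, hN']; ring
    obtain ⟨x₀, hx⟩ := indicator4_of_disjoint d12 d13 d14 d23 d24 d34 hc
    refine ⟨x₀, fun y => ?_⟩
    have := hx y
    simp only [mem_image_add] at this
    exact this
  · -- (ii'): vertex 000 of `(S, T·τ0, U)`
    have er : (Equiv.mulRight (1 : G)).toEmbedding = Function.Embedding.refl G := by ext x; simp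
    have hT' := h.map_mulRight 1 (τ 0) 1
    simp only [er, Finset.map_refl] at hT'
    have memρ : ∀ (X : Finset G) (b : A), ρ b ∈ X.map (Equiv.mulRight (τ 0)).toEmbedding ↔ τ (-c₀ - b) ∈ X := by
      intro X b
      simp only [Finset.mem_map_equiv, Equiv.mulRight_symm_apply]
      rw [inv_tau hρρ hττ, hρτ, zero_sub]
    have memτ : ∀ (X : Finset G) (b : A), τ b ∈ X.map (Equiv.mulRight (τ 0)).toEmbedding ↔ ρ (-b) ∈ X := by
      intro X b
      simp only [Finset.mem_map_equiv, Equiv.mulRight_symm_apply]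
      rw [inv_tau hρρ hττ, hττ]
      have e : c₀ + (0 - c₀) - b = -b := by abel
      rw [e]
    have mT'₀ : ∀ b ∈ ({-c₀ - (b₃ + t'), -c₀ - (b₃ + t') + t'} : Finset A),
        ρ b ∈ T.map (Equiv.mulRight (τ 0)).toEmbedding := by
      intro b hb
      rw [memρ]
      rcases mem_insert.1 hb with rfl | hb
      · rw [show -c₀ - (-c₀ - (b₃ + t')) = b₃ + t' by abel]
        exact mT₁ _ (mem_insert_of_mem (mem_singleton_self _))
      · rw [mem_singleton] at hb; subst hb
        rw [show -c₀ - (-c₀ - (b₃ + t') + t') = b₃ by abel]; exact mT₁ _ (mem_insert_self _ _)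
    have mT'₁ : ∀ b ∈ ({-(b₁ + t), -(b₁ + t) + t} : Finset A), τ b ∈ T.map (Equiv.mulRight (τ 0)).toEmbedding := by
      intro b hb
      rw [memτ]
      rcases mem_insert.1 hb with rfl | hb
      · rw [neg_neg]; exact mT₀ _ (mem_insert_of_mem (mem_singleton_self _))
      · rw [mem_singleton] at hb; subst hb
        rw [show -(-(b₁ + t) + t) = b₁ by abel]; exact mT₀ _ (mem_insert_self _ _)
    obtain ⟨f12, f13, f14, f23, f24, f34, cM', cP'⟩ :=
      vertex000_pieces hρρ hρτ hτρ hττ hρ hτ hne hT' ht' ht mT'₀ mT'₁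
    -- express the primed pieces as translates of `M`, `P`
    rw [image_sum_shift (S₁ ×ˢ U₀) b₁ (-c₀ - (b₃ + t')), image_sum_shift (S₀ ×ˢ U₁) b₁ (-c₀ - (b₃ + t')),
      ← image_union] at f12 f13 f14 f23 f24 cM'
    rw [image_sum_shift (S₀ ×ˢ U₀) b₃ (-(b₁ + t))] at f13 f14 f23 f24 f34 cP'
    set δ := -c₀ - (b₃ + t') - b₁ with hδ
    set ε := -(b₁ + t) - b₃ with hε
    have hc : (M.image (· + δ)).card + ((M.image (· + δ)).image (· + t')).card +
        ((P.image (· + ε)).image (· + t)).card + (P.image (· + ε)).card + 1 = Fintype.card A := by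
      rw [card_image_add, card_image_add, card_image_add, card_image_add, card_image_add, hN']; ring
    obtain ⟨x₂, hx⟩ := indicator4_of_disjoint f12 f14 f13 f24 f23 f34.symm hc
    refine ⟨x₂ - δ, fun y => ?_⟩
    have := hx (y + δ)
    have r1 : y + δ - δ = y := by abel
    have r2 : ∀ w : A, y + δ - w - δ = y - w := fun w => by abel
    have r3 : y + δ - t - ε = y - t' := by rw [hδ, hε, hc₀]; abel
    have r4 : y + δ - ε = y - (t' - t) := by rw [hδ, hε, hc₀]; abel
    have r5 : (y + δ = x₂) ↔ (y = x₂ - δ) := eq_sub_iff_add_eq.symm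
    simp only [mem_image_add, r1, r2, r3, r4, r5] at this
    exact this

/-- **Cube law shapes with a part pair of size 2 force `A` cyclic.**  Dihedral-like `G` over `A`; a TPP triple
with `T`-parts `{b₁, b₁+t}`, `{b₃, b₃+t'}` (`t, t' ≠ 0`), equal `S`-parts, equal `U`-parts, attaining the law
`3|S||T||U| + 8 = 8|A|`: then `A = ⟨g⟩` for some `g`.  (ω-census family (b3): the cube shapes `(c,c|2,2|e,e)` of the
`|A| ≡ 1 (mod 3)` law classification occur only over cyclic `A`.) [folklore] -/
theorem cyclic_of_law_cube_pair
    (hρρ : ∀ a b, ρ a * ρ b = ρ (a + b)) (hρτ : ∀ a b, ρ a * τ b = τ (b - a))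
    (hτρ : ∀ a b, τ a * ρ b = τ (a + b)) (hττ : ∀ a b, τ a * τ b = ρ (c₀ + b - a))
    (hρ : Function.Injective ρ) (hτ : Function.Injective τ) (hne : ∀ a b, ρ a ≠ τ b)
    (hsurj : ∀ g, (∃ a, ρ a = g) ∨ (∃ a, τ a = g)) (h : TripleProductProperty S T U) {b₁ b₃ t t' : A}
    (ht : t ≠ 0) (ht' : t' ≠ 0)
    (hT₀ : (univ.filter fun a : A => ρ a ∈ T) = {b₁, b₁ + t})
    (hT₁ : (univ.filter fun a : A => τ a ∈ T) = {b₃, b₃ + t'})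
    (hS : (univ.filter fun a : A => ρ a ∈ S).card = (univ.filter fun a : A => τ a ∈ S).card)
    (hU : (univ.filter fun a : A => ρ a ∈ U).card = (univ.filter fun a : A => τ a ∈ U).card)
    (hV : 3 * (S.card * T.card * U.card) + 8 = 8 * Fintype.card A) :
    ∃ g : A, AddSubgroup.zmultiples g = ⊤ := by
  obtain ⟨⟨x₀, hi⟩, ⟨x₀', hii⟩, hMP, hN⟩ :=
    cube_pair_indicator_identities hρρ hρτ hτρ hττ hρ hτ hne hsurj h ht ht' hT₀ hT₁ hS hU hV
  exact exists_zmultiples_eq_top_of_near_tilings hi hii hMP hN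

/-- The same with the `T`-parts written as `{b₁, b₂}`, `{b₃, b₄}`. [folklore] -/
theorem cyclic_of_law_cube_two_pair
    (hρρ : ∀ a b, ρ a * ρ b = ρ (a + b)) (hρτ : ∀ a b, ρ a * τ b = τ (b - a))
    (hτρ : ∀ a b, τ a * ρ b = τ (a + b)) (hττ : ∀ a b, τ a * τ b = ρ (c₀ + b - a))
    (hρ : Function.Injective ρ) (hτ : Function.Injective τ) (hne : ∀ a b, ρ a ≠ τ b)
    (hsurj : ∀ g, (∃ a, ρ a = g) ∨ (∃ a, τ a = g)) (h : TripleProductProperty S T U) {b₁ b₂ b₃ b₄ : A}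
    (h12 : b₁ ≠ b₂) (h34 : b₃ ≠ b₄)
    (hT₀ : (univ.filter fun a : A => ρ a ∈ T) = {b₁, b₂})
    (hT₁ : (univ.filter fun a : A => τ a ∈ T) = {b₃, b₄})
    (hS : (univ.filter fun a : A => ρ a ∈ S).card = (univ.filter fun a : A => τ a ∈ S).card)
    (hU : (univ.filter fun a : A => ρ a ∈ U).card = (univ.filter fun a : A => τ a ∈ U).card)
    (hV : 3 * (S.card * T.card * U.card) + 8 = 8 * Fintype.card A) :
    ∃ g : A, AddSubgroup.zmultiples g = ⊤ :=
  cyclic_of_law_cube_pair hρρ hρτ hτρ hττ hρ hτ hne hsurj h (t := b₂ - b₁) (t' := b₄ - b₃)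
    (sub_ne_zero.2 (Ne.symm h12)) (sub_ne_zero.2 (Ne.symm h34))
    (by rw [hT₀, show b₁ + (b₂ - b₁) = b₂ by abel]) (by rw [hT₁, show b₃ + (b₄ - b₃) = b₄ by abel]) hS hU hV

/-- **Cube law shapes with a part pair of size 2 are cyclic, given a generator among `t ± t′`.**  Dihedral-like `G`
over `A`; a TPP triple with `T`-parts `{b₁, b₁+t}`, `{b₃, b₃+t'}` (`t, t' ≠ 0`), equal `S`-parts, equal `U`-parts,
attaining the law `3|S||T||U| + 8 = 8|A|`.  If `t + t'` or `t' − t` generates `A`, then `t' = ±t` and every element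
of `A` lies in `x₀ + ⟨t⟩`: `A` is cyclic, generated by `t`.  (ω-census family (b3); conditional form of
"cube shapes with a 2-pair force `A` cyclic" — the generator hypothesis is what Lemma Q (c) would remove.) [folklore] -/
theorem cyclic_of_law_cube_pair_of_generator
    (hρρ : ∀ a b, ρ a * ρ b = ρ (a + b)) (hρτ : ∀ a b, ρ a * τ b = τ (b - a))
    (hτρ : ∀ a b, τ a * ρ b = τ (a + b)) (hττ : ∀ a b, τ a * τ b = ρ (c₀ + b - a))
    (hρ : Function.Injective ρ) (hτ : Function.Injective τ) (hne : ∀ a b, ρ a ≠ τ b)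
    (hsurj : ∀ g, (∃ a, ρ a = g) ∨ (∃ a, τ a = g)) (h : TripleProductProperty S T U) {b₁ b₃ t t' : A}
    (ht : t ≠ 0) (ht' : t' ≠ 0)
    (hT₀ : (univ.filter fun a : A => ρ a ∈ T) = {b₁, b₁ + t})
    (hT₁ : (univ.filter fun a : A => τ a ∈ T) = {b₃, b₃ + t'})
    (hS : (univ.filter fun a : A => ρ a ∈ S).card = (univ.filter fun a : A => τ a ∈ S).card)
    (hU : (univ.filter fun a : A => ρ a ∈ U).card = (univ.filter fun a : A => τ a ∈ U).card)
    (hV : 3 * (S.card * T.card * U.card) + 8 = 8 * Fintype.card A)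
    (hgen : AddSubgroup.zmultiples (t + t') = ⊤ ∨ AddSubgroup.zmultiples (t' - t) = ⊤) :
    (t' = t ∨ t' = -t) ∧ ∃ x₀ : A, ∀ y : A, y - x₀ ∈ AddSubgroup.zmultiples t := by
  obtain ⟨⟨x₀, hi⟩, ⟨x₀', hii⟩, hMP, hN⟩ :=
    cube_pair_indicator_identities hρρ hρτ hτρ hττ hρ hτ hne hsurj h ht ht' hT₀ hT₁ hS hU hV
  have hal := aligned_of_generator hi hii hMP hN hgen
  refine ⟨hal, ?_⟩
  rcases hal with e | e
  · subst e
    exact cyclic_of_law_cube_aligned_pair hρρ hρτ hτρ hττ hρ hτ hne hsurj h ht hT₀ hT₁ hS hU hV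
  · subst e
    have hT₁' : (univ.filter fun a : A => τ a ∈ T) = {b₃ + -t, b₃ + -t + t} := by
      rw [show b₃ + -t + t = b₃ by abel, pair_comm]; exact hT₁
    exact cyclic_of_law_cube_aligned_pair hρρ hρτ hτρ hττ hρ hτ hne hsurj h ht hT₀ hT₁' hS hU hV

end DihedralLike

end Summit.MatrixMultiplication.OmegaCensus
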